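import Mathlib
import HarnessLib
import Literature.Analysis.FluidPDE.VorticityCalculus
import Summits.NavierStokesRegularity.NavierStokesRegularity.Theorems.ThreadingFluxCentreJetVorticityJet

/-!
# Route `UnthreadedDoor` / `ThreadingFlux`, crux `PoloidalLiouville` (stmt-NavierStokesRegularity-1222), antidynamo v2 skeleton (sha16 `4ebf5683127b`),
# WALL `stub_scalarLiouville`: at the CENTRE, the symmetry defect of the vorticity about its own rotation axis vanishes to FIRST ORDER for free

Support file (seat leafhand-ns-unthreadeddoor-3 g15, cell decomp-ns), `--supports stmt-NavierStokesRegularity-1222 --as helper`; theorems only.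
Companion of `UnthreadedDoorPoloidalLiouvilleOfVorticityGermRigidity.lean` (p834435), whose closer `FrameSlot.constant_of_fderiv_curl_skew_jet`
finishes the wall as soon as, at ONE instant, ALL diagonal Taylor terms of the symmetry defect
`F(x) = D(curl v)(x)[A (x − x₁)] − A (curl v x)` vanish at ONE point for ONE skew `A ≠ 0`.  Here: for a `C³` field `V` unthreaded about `x₀`
(vortex lines on the spheres about `x₀`, frozen time) and the CANONICAL choice `x₁ = x₂ = x₀`, `A = D(curl V)(x₀)` — which is skew by the centre
kinematics `CentreJet.centreVorticityJet` (E1 of the steady centre-jet sieve: `curl V x₀ = 0`, `⟪y, D(curl V)(x₀) y⟫ = 0`) — the defect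
vanishes at `x₀` TOGETHER WITH ITS FIRST DERIVATIVE, identically:

* `FrameSlot.centreDefect_apply_centre` — `F(x₀) = 0` (because `curl V x₀ = 0`);
* `FrameSlot.fderiv_centreDefect_centre` — `DF(x₀) = A ∘ A − A ∘ A = 0` (Leibniz rule for the evaluation `x ↦ D(curl V)(x)[A(x − x₀)]`, whose
  second factor vanishes at `x₀`);
* `FrameSlot.centreDefect_skew` — `⟪A x, x⟫ = 0`, the skewness clause of the closers, read off (E1).

So the jet hypothesis of p834435 at the centre with the canonical axis STARTS AT ORDER 2: its first non-trivial clause is the equivariance of the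
quadratic vorticity jet `ω₂` under `A` (for `A ≠ 0`: zonality of the quadratic toroidal potential about the centre's vorticity-rotation axis) —
exactly the datum `Q ∈ 𝓗₂` that the steady centre-jet sieve finds FREE at low degree (CentreJetSieve-RESULTS §2, k = 2) and killed only through
the all-order tower (§4b: real non-axisymmetric 11-jets, obstructed at 12).  HONEST LABEL: elementary calculus bookkeeping (orders 0 and 1 of
the interface between the jet closer and the sieve); nothing here proves `stub_scalarLiouville`, `PoloidalLiouville` (1222) or bears on NS
regularity; no summit statement is proved. [folklore] [cite: MajdaBertozziCUP2002, §1.1, §2.3.3]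
-/

noncomputable section

-- the summit and its single sub-problem share the name (CONVENTIONS §1)
set_option linter.dupNamespace false

open scoped Topology InnerProductSpace RealInnerProductSpace ContDiff
open Filter Set Function
open Literature.Analysis Literature.Analysis.FluidPDE

namespace Summit.NavierStokesRegularity.NavierStokesRegularity.Theorems.PoloidalLiouville.Antidynamo

namespace FrameSlot

/-- **Skewness of the canonical axis map** `A = D(curl V)(x₀)` of a `C³` field unthreaded about `x₀`: `⟪A x, x⟫ = 0` (E1 of the centre-jet
sieve, `CentreJet.centreVorticityJet`, with the inner product flipped to the closers' convention). [cite: MajdaBertozziCUP2002, §1.1] -/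
theorem centreDefect_skew (V : EuclideanSpace ℝ (Fin 3) → EuclideanSpace ℝ (Fin 3)) (x₀ : EuclideanSpace ℝ (Fin 3))
    (hV : ContDiff ℝ 3 V) (hun : ∀ x, ⟪x - x₀, curl V x⟫ = 0) :
    ∀ x, ⟪fderiv ℝ (curl V) x₀ x, x⟫ = 0 := by
  intro x
  rw [real_inner_comm]
  exact (CentreJet.centreVorticityJet V x₀ hV hun).2.1 x

/-- **Order 0: the canonical symmetry defect vanishes at the centre.**  For `V ∈ C³` unthreaded about `x₀` and `A = D(curl V)(x₀)`:
`D(curl V)(x₀)[A(x₀ − x₀)] − A (curl V x₀) = 0`, because `curl V x₀ = 0` (E1). [cite: MajdaBertozziCUP2002, §1.1] -/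
theorem centreDefect_apply_centre (V : EuclideanSpace ℝ (Fin 3) → EuclideanSpace ℝ (Fin 3)) (x₀ : EuclideanSpace ℝ (Fin 3))
    (hV : ContDiff ℝ 3 V) (hun : ∀ x, ⟪x - x₀, curl V x⟫ = 0) :
    fderiv ℝ (curl V) x₀ (fderiv ℝ (curl V) x₀ (x₀ - x₀)) - fderiv ℝ (curl V) x₀ (curl V x₀) = 0 := by
  rw [(CentreJet.centreVorticityJet V x₀ hV hun).1, sub_self, map_zero, map_zero, sub_self]

/-- **Order 1: the derivative of the canonical symmetry defect vanishes at the centre.**  For `V ∈ C³` unthreaded about `x₀` and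
`A = D(curl V)(x₀)`, the map `F(x) = D(curl V)(x)[A(x − x₀)] − A (curl V x)` has `DF(x₀) = A ∘ A − A ∘ A = 0`: by the Leibniz rule for the
evaluation, `D(x ↦ D(curl V)(x)[A(x − x₀)])(x₀) = D(curl V)(x₀) ∘ A + (D²(curl V)(x₀))ᵀ[A(x₀ − x₀)] = A ∘ A`, and `D(A ∘ curl V)(x₀) = A ∘ A`.
(Only `curl V ∈ C²` is used here; unthreadedness enters the ORDER-0 clause and the skewness of `A`.) [cite: MajdaBertozziCUP2002, §1.1] -/
theorem fderiv_centreDefect_centre (V : EuclideanSpace ℝ (Fin 3) → EuclideanSpace ℝ (Fin 3)) (x₀ : EuclideanSpace ℝ (Fin 3))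
    (hV : ContDiff ℝ 3 V) :
    fderiv ℝ (fun x => fderiv ℝ (curl V) x (fderiv ℝ (curl V) x₀ (x - x₀)) - fderiv ℝ (curl V) x₀ (curl V x)) x₀ = 0 := by
  set A : EuclideanSpace ℝ (Fin 3) →L[ℝ] EuclideanSpace ℝ (Fin 3) := fderiv ℝ (curl V) x₀ with hA
  have hω : ContDiff ℝ 2 (curl V) := by
    rw [curl_eq_curlCLM_comp]
    exact curlCLM.contDiff.comp (hV.fderiv_right (m := 2) (by norm_num))
  have hω1 : Differentiable ℝ (curl V) := hω.differentiable (by norm_num)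
  have hDω : Differentiable ℝ (fderiv ℝ (curl V)) :=
    (hω.fderiv_right (m := 1) (by norm_num)).differentiable (by norm_num)
  -- the linear field `x ↦ A (x − x₀)` and its derivative
  have hu : Differentiable ℝ (fun x : EuclideanSpace ℝ (Fin 3) => A (x - x₀)) :=
    A.differentiable.comp (differentiable_id.sub_const x₀)
  have hfu : fderiv ℝ (fun x : EuclideanSpace ℝ (Fin 3) => A (x - x₀)) x₀ = A := by
    have h1 : HasFDerivAt (fun x : EuclideanSpace ℝ (Fin 3) => x - x₀) (ContinuousLinearMap.id ℝ _) x₀ :=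
      (hasFDerivAt_id x₀).sub_const x₀
    have h2 : HasFDerivAt (fun x : EuclideanSpace ℝ (Fin 3) => A (x - x₀))
        (A.comp (ContinuousLinearMap.id ℝ _)) x₀ := A.hasFDerivAt.comp x₀ h1
    rw [h2.fderiv, ContinuousLinearMap.comp_id]
  -- Leibniz rule for the evaluation and the chain rule for `A ∘ curl V`
  have hd1 : DifferentiableAt ℝ (fun x => fderiv ℝ (curl V) x (A (x - x₀))) x₀ := (hDω x₀).clm_apply (hu x₀)
  have hd2 : DifferentiableAt ℝ (fun x => A (curl V x)) x₀ := (A.differentiableAt).comp x₀ (hω1 x₀)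
  have e1 : fderiv ℝ (fun x => fderiv ℝ (curl V) x (A (x - x₀))) x₀ = A.comp A := by
    rw [fderiv_clm_apply (hDω x₀) (hu x₀), hfu, sub_self, map_zero, map_zero, add_zero]
  have e2 : fderiv ℝ (fun x => A (curl V x)) x₀ = A.comp A := by
    rw [show (fun x => A (curl V x)) = A ∘ curl V from rfl, fderiv_comp x₀ A.differentiableAt (hω1 x₀), A.fderiv, hA]
  rw [fderiv_fun_sub hd1 hd2, e1, e2, sub_self]

end FrameSlot

end Summit.NavierStokesRegularity.NavierStokesRegularity.Theorems.PoloidalLiouville.Antidynamo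

end
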